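import Mathlib.Combinatorics.SimpleGraph.Connectivity.Connected
import Literature.MathematicalPhysics.QuantumLattice.PerronFrobeniusGroundState
import Literature.MathematicalPhysics.QuantumLattice.SectorSpectrum
import Literature.MathematicalPhysics.QuantumLattice.SpinSystem

/-!
# Route `AnisotropyChord` / H0 rotor rung, route (1), hypothesis (H3) = THEOREM Z⁺: the FLIP-PARITY BLOCKS
# (combinatorics of double flips + Perron–Frobenius on a parity block)

Ingredients for THEOREM Z⁺ (theory seat `hubbard-h0-rotor-theory-1`, THEOREM-Z.md, memo ROTOR-THEORY-11 §176: the easy-plane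
XXZ ferromagnet has its ground state in `Sᶻ_tot = 0`), which in the rotated (`Sʸ`-quantised) frame is a statement about a
stoquastic matrix `H` on spin-½ configurations `σ : Λ → Fin 2` whose off-diagonal entries flip TWO spins across a bond:

* `flipAt x σ` — the configuration with the spin at `x` reversed; weight/parity bookkeeping (`weight_flipAt`,
  `weight_flipAt_mod_two`, `weight_flipAt_flipAt_mod_two`);
* **ergodicity of double flips inside a parity class** (`reflTransGen_doubleFlip_of_parity`): on a connected graph, any two
  configurations with the same parity of `Σ_z σ_z` are joined by a chain of double flips `σ ↦ flipAt x (flipAt y σ)` across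
  edges `x ∼ y` (flip along a walk joining two discrepancies: the interior vertices are flipped twice);
* **Perron–Frobenius on a parity block** (`parityBlock_perronFrobenius_pos`, `parityBlock_perronFrobenius_unique`): for `H` with
  real symmetric entries, non-positive off the diagonal, zero between the two parity classes and non-zero on every edge double
  flip, and `E` a lower bound of its quadratic form, a non-zero solution of `H w = E w` supported in one parity class is a multiple
  of a vector that is strictly positive on that class, and two such solutions are proportional (compression to the class +
  `perronFrobenius_groundState_smul_pos/unique` of `Literature…PerronFrobeniusGroundState`, as in the tree's
  `stoquastic_sector_perronFrobenius` for weight sectors).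

All statements are folklore (Perron 1907 / Frobenius 1912; Lieb–Wu 2003 §2; Tasaki 2020 §2.4).  Prover seat `hubbard-h0-rotor-p1` g14.
-/

set_option linter.dupNamespace false
set_option autoImplicit false

noncomputable section

open Finset Matrix
open scoped ComplexOrder
open Literature.MathematicalPhysics.QuantumLattice

namespace Summit.HubbardSuperconductivity.HubbardSuperconductivity.Theorems.AnisotropyChord.Transfer

section Flips

variable {Λ : Type*} [Fintype Λ] [DecidableEq Λ]

/-! ## Single and double spin flips -/

/-- the configuration `σ` with the spin at `x` reversed (`0 ↔ 1`). [folklore] -/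
def flipAt (x : Λ) (σ : Λ → Fin 2) : Λ → Fin 2 := Function.update σ x (1 - σ x)

omit [Fintype Λ] in
/-- value at the flipped site. [folklore] -/
@[simp] theorem flipAt_apply_self (x : Λ) (σ : Λ → Fin 2) : flipAt x σ x = 1 - σ x := by
  simp [flipAt]

omit [Fintype Λ] in
/-- values off the flipped site. [folklore] -/
theorem flipAt_apply_of_ne {x z : Λ} (σ : Λ → Fin 2) (h : z ≠ x) : flipAt x σ z = σ z := by
  simp [flipAt, Function.update_of_ne h]

/-- two distinct elements of `Fin 2` are each other's reverse. [folklore] -/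
private theorem fin2_eq_sub_of_ne {a b : Fin 2} (h : a ≠ b) : b = 1 - a := by
  fin_cases a <;> fin_cases b <;> simp_all

/-- the value of `1 - a` as a natural number. [folklore] -/
private theorem fin2_val_sub (a : Fin 2) : (((1 : Fin 2) - a : Fin 2) : ℕ) + (a : ℕ) = 1 := by
  fin_cases a <;> rfl

omit [Fintype Λ] in
/-- `flipAt x` is an involution. [folklore] -/
@[simp] theorem flipAt_flipAt (x : Λ) (σ : Λ → Fin 2) : flipAt x (flipAt x σ) = σ := by
  funext z
  by_cases hz : z = x
  · subst hz; simp
  · simp [flipAt_apply_of_ne _ hz]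

omit [Fintype Λ] in
/-- flips at different sites commute. [folklore] -/
theorem flipAt_comm (x y : Λ) (σ : Λ → Fin 2) : flipAt x (flipAt y σ) = flipAt y (flipAt x σ) := by
  by_cases hxy : x = y
  · subst hxy; rfl
  funext z
  by_cases hzx : z = x
  · subst hzx
    rw [flipAt_apply_self, flipAt_apply_of_ne _ hxy, flipAt_apply_of_ne _ hxy, flipAt_apply_self]
  · by_cases hzy : z = y
    · subst hzy
      rw [flipAt_apply_of_ne _ hzx, flipAt_apply_self, flipAt_apply_self, flipAt_apply_of_ne _ hzx]
    · rw [flipAt_apply_of_ne _ hzx, flipAt_apply_of_ne _ hzy, flipAt_apply_of_ne _ hzy, flipAt_apply_of_ne _ hzx]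

/-- **weight of a single flip**: `w(flipAt x σ) + 2σ_x = w(σ) + 1`. [folklore] -/
theorem weight_flipAt (x : Λ) (σ : Λ → Fin 2) :
    (∑ z, (flipAt x σ z : ℕ)) + 2 * (σ x : ℕ) = (∑ z, (σ z : ℕ)) + 1 := by
  have h1 := (Finset.add_sum_erase (Finset.univ) (fun z => (flipAt x σ z : ℕ)) (Finset.mem_univ x))
  have h2 := (Finset.add_sum_erase (Finset.univ) (fun z => (σ z : ℕ)) (Finset.mem_univ x))
  have hrest : ∑ z ∈ Finset.univ.erase x, (flipAt x σ z : ℕ) = ∑ z ∈ Finset.univ.erase x, (σ z : ℕ) :=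
    Finset.sum_congr rfl fun z hz => by rw [flipAt_apply_of_ne _ (Finset.ne_of_mem_erase hz)]
  rw [← h1, ← h2, hrest, flipAt_apply_self]
  have := fin2_val_sub (σ x)
  omega

/-- a single flip changes the parity of the weight. [folklore] -/
theorem weight_flipAt_mod_two (x : Λ) (σ : Λ → Fin 2) :
    (∑ z, (flipAt x σ z : ℕ)) % 2 ≠ (∑ z, (σ z : ℕ)) % 2 := by
  have := weight_flipAt x σ
  omega

/-- a double flip preserves the parity of the weight. [folklore] -/
theorem weight_flipAt_flipAt_mod_two (x y : Λ) (σ : Λ → Fin 2) :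
    (∑ z, (flipAt x (flipAt y σ) z : ℕ)) % 2 = (∑ z, (σ z : ℕ)) % 2 := by
  have h1 := weight_flipAt_mod_two x (flipAt y σ)
  have h2 := weight_flipAt_mod_two y σ
  omega

/-! ## Ergodicity of edge double flips inside a parity class -/

variable (G : SimpleGraph Λ)

/-- the edge double-flip relation `τ = flipAt x (flipAt y σ)`, `x ∼ y`. [folklore] -/
def DoubleFlipRel (σ τ : Λ → Fin 2) : Prop := ∃ x y : Λ, G.Adj x y ∧ τ = flipAt x (flipAt y σ)

omit [Fintype Λ] in
/-- flipping along a walk from `a` to `b` realises the double flip at the endpoints `a, b` as a chain of edge double flips.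
[folklore] -/
theorem reflTransGen_doubleFlip_walk {a b : Λ} (w : G.Walk a b) (σ : Λ → Fin 2) :
    Relation.ReflTransGen (DoubleFlipRel G) σ (flipAt a (flipAt b σ)) := by
  induction w generalizing σ with
  | nil => rw [flipAt_flipAt]
  | @cons u v c huv w' ih =>
    have hstep : DoubleFlipRel G σ (flipAt u (flipAt v σ)) := ⟨u, v, huv, rfl⟩
    have hrest := ih (flipAt u (flipAt v σ))
    have e : flipAt v (flipAt c (flipAt u (flipAt v σ))) = flipAt u (flipAt c σ) := by
      rw [flipAt_comm u v, flipAt_comm c v, flipAt_flipAt, flipAt_comm]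
    rw [e] at hrest
    exact Relation.ReflTransGen.head hstep hrest

omit [DecidableEq Λ] in
/-- the discrepancy set of two configurations. [folklore] -/
private theorem card_filter_ne_eq_zero_iff (σ τ : Λ → Fin 2) :
    (Finset.univ.filter fun z => σ z ≠ τ z).card = 0 ↔ σ = τ := by
  rw [Finset.card_eq_zero, Finset.filter_eq_empty_iff]
  constructor
  · intro h; funext z; by_contra hz; exact h (Finset.mem_univ z) hz
  · intro h z _ hz; exact hz (by rw [h])

/-- two configurations differing at exactly one site differ in parity. [folklore] -/
private theorem parity_ne_of_card_filter_eq_one {σ τ : Λ → Fin 2}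
    (h : (Finset.univ.filter fun z => σ z ≠ τ z).card = 1) :
    (∑ z, (σ z : ℕ)) % 2 ≠ (∑ z, (τ z : ℕ)) % 2 := by
  obtain ⟨x, hx⟩ := Finset.card_eq_one.mp h
  have hxmem : σ x ≠ τ x := by
    have : x ∈ Finset.univ.filter fun z => σ z ≠ τ z := by rw [hx]; exact Finset.mem_singleton_self x
    exact (Finset.mem_filter.mp this).2
  have hτ : τ = flipAt x σ := by
    funext z
    by_cases hz : z = x
    · subst hz; rw [flipAt_apply_self]; exact fin2_eq_sub_of_ne hxmem
    · rw [flipAt_apply_of_ne _ hz]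
      by_contra hne
      have : z ∈ Finset.univ.filter fun z => σ z ≠ τ z := Finset.mem_filter.mpr ⟨Finset.mem_univ z, Ne.symm hne⟩
      rw [hx, Finset.mem_singleton] at this
      exact hz this
  rw [hτ]
  exact (weight_flipAt_mod_two x σ).symm

/-- removing two discrepancies by a double flip. [folklore] -/
private theorem card_filter_doubleFlip {σ τ : Λ → Fin 2} {x y : Λ} (hxy : x ≠ y) (hx : σ x ≠ τ x) (hy : σ y ≠ τ y) :
    (Finset.univ.filter fun z => flipAt x (flipAt y σ) z ≠ τ z).card + 2 =
      (Finset.univ.filter fun z => σ z ≠ τ z).card := by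
  have hsub : (Finset.univ.filter fun z => flipAt x (flipAt y σ) z ≠ τ z) =
      ((Finset.univ.filter fun z => σ z ≠ τ z).erase x).erase y := by
    ext z
    simp only [Finset.mem_filter, Finset.mem_univ, true_and, Finset.mem_erase]
    by_cases hzx : z = x
    · subst hzx
      rw [flipAt_apply_self, flipAt_apply_of_ne _ hxy]
      constructor
      · intro h; exact absurd (fin2_eq_sub_of_ne hx).symm h
      · intro h; exact absurd rfl h.2.1
    · by_cases hzy : z = y
      · subst hzy
        rw [flipAt_apply_of_ne _ hzx, flipAt_apply_self]
        constructor
        · intro h; exact absurd (fin2_eq_sub_of_ne hy).symm h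
        · intro h; exact absurd rfl h.1
      · rw [flipAt_apply_of_ne _ hzx, flipAt_apply_of_ne _ hzy]
        constructor
        · intro h; exact ⟨hzy, hzx, h⟩
        · intro h; exact h.2.2
  rw [hsub]
  have hxm : x ∈ Finset.univ.filter fun z => σ z ≠ τ z := Finset.mem_filter.mpr ⟨Finset.mem_univ x, hx⟩
  have hym : y ∈ (Finset.univ.filter fun z => σ z ≠ τ z).erase x :=
    Finset.mem_erase.mpr ⟨Ne.symm hxy, Finset.mem_filter.mpr ⟨Finset.mem_univ y, hy⟩⟩
  rw [Finset.card_erase_of_mem hym, Finset.card_erase_of_mem hxm]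
  have : 2 ≤ (Finset.univ.filter fun z => σ z ≠ τ z).card := by
    have h1 := Finset.card_pos.mpr ⟨y, hym⟩
    rw [Finset.card_erase_of_mem hxm] at h1
    omega
  omega

/-- **Ergodicity of edge double flips inside a parity class**: on a connected graph, two spin-½ configurations with the same
parity of `Σ_z σ_z` are joined by a chain of double flips across edges. [folklore] -/
theorem reflTransGen_doubleFlip_of_parity (hG : G.Connected) (σ τ : Λ → Fin 2)
    (hpar : (∑ z, (σ z : ℕ)) % 2 = (∑ z, (τ z : ℕ)) % 2) :
    Relation.ReflTransGen (DoubleFlipRel G) σ τ := by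
  -- induction on the number of discrepancies
  suffices key : ∀ k (σ : Λ → Fin 2), (Finset.univ.filter fun z => σ z ≠ τ z).card = k →
      (∑ z, (σ z : ℕ)) % 2 = (∑ z, (τ z : ℕ)) % 2 → Relation.ReflTransGen (DoubleFlipRel G) σ τ from
    key _ σ rfl hpar
  intro k
  induction k using Nat.strong_induction_on with
  | _ k ih =>
    intro σ hk hpar
    by_cases h0 : k = 0
    · subst h0
      rw [(card_filter_ne_eq_zero_iff σ τ).mp hk]
    by_cases h1 : k = 1
    · subst h1
      exact absurd hpar (parity_ne_of_card_filter_eq_one hk)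
    -- two distinct discrepancies
    have hk2 : 1 < (Finset.univ.filter fun z => σ z ≠ τ z).card := by rw [hk]; omega
    obtain ⟨x, hx, y, hy, hxy⟩ := Finset.one_lt_card.mp hk2
    have hx' := (Finset.mem_filter.mp hx).2
    have hy' := (Finset.mem_filter.mp hy).2
    obtain ⟨w⟩ := hG.preconnected x y
    have hwalk := reflTransGen_doubleFlip_walk G w σ
    have hcard := card_filter_doubleFlip hxy hx' hy'
    rw [hk] at hcard
    have hrest := ih (k - 2) (by omega) (flipAt x (flipAt y σ)) (by omega)
      (by rw [weight_flipAt_flipAt_mod_two]; exact hpar)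
    exact hwalk.trans hrest

end Flips

/-! ## Perron–Frobenius on a parity block -/

section Block

variable {Λ : Type*} [Fintype Λ] [DecidableEq Λ] (G : SimpleGraph Λ)

/-- **Perron–Frobenius on a parity block (positivity and uniqueness).**  Let `H` be a matrix on spin-½ configurations with real
symmetric entries, non-positive off the diagonal and non-zero on every edge double flip of a connected graph `G` (entries
between the two parity classes play no role: the eigen-equation is assumed on the whole space); let `E` bound its quadratic form from below (`E‖v‖² ≤ Re⟨v, Hv⟩`).  Then for each
parity `r`: (1) a non-zero solution of `H w = E w` supported in the parity class `r` becomes, after multiplication by a non-zero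
constant, real and strictly positive on the whole class; (2) two solutions supported in the class, the first non-zero, are
proportional.  (Compression to the class; ergodicity `reflTransGen_doubleFlip_of_parity`; `perronFrobenius_groundState_smul_pos`
/ `_unique`.)  Lieb–Wu, Physica A 321 (2003) §2; Tasaki (2020) §2.4. [folklore] -/
theorem parityBlock_perronFrobenius (hG : G.Connected) (H : Op Λ 2)
    (hreal : ∀ σ τ : TensorIndex Λ 2, star (H σ τ) = H σ τ)
    (hsymm : ∀ σ τ : TensorIndex Λ 2, H σ τ = H τ σ)
    (hoff : ∀ σ τ : TensorIndex Λ 2, σ ≠ τ → (H σ τ).re ≤ 0)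
    (hflip : ∀ (x y : Λ) (σ : TensorIndex Λ 2), G.Adj x y → H σ (flipAt x (flipAt y σ)) ≠ 0)
    {E : ℝ} (hE : ∀ v : TensorIndex Λ 2 → ℂ, E * (star v ⬝ᵥ v).re ≤ (star v ⬝ᵥ H *ᵥ v).re) (r : ℕ) :
    (∀ w : TensorIndex Λ 2 → ℂ, w ≠ 0 → (∀ σ, (∑ z, (σ z : ℕ)) % 2 ≠ r → w σ = 0) →
      H *ᵥ w = (E : ℂ) • w →
        ∃ c : ℂ, c ≠ 0 ∧ ∀ σ, (∑ z, (σ z : ℕ)) % 2 = r → 0 < (c * w σ).re ∧ (c * w σ).im = 0) ∧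
    (∀ w w' : TensorIndex Λ 2 → ℂ, (∀ σ, (∑ z, (σ z : ℕ)) % 2 ≠ r → w σ = 0) →
      (∀ σ, (∑ z, (σ z : ℕ)) % 2 ≠ r → w' σ = 0) →
      H *ᵥ w = (E : ℂ) • w → H *ᵥ w' = (E : ℂ) • w' → w ≠ 0 → ∃ c : ℂ, w' = c • w) := by
  -- the compression of `H` to the class
  set ι := {σ : TensorIndex Λ 2 // (∑ z, (σ z : ℕ)) % 2 = r}
  set B : Matrix ι ι ℂ := Matrix.of fun s t => H s.1 t.1 with hBdef
  have hBapply : ∀ s t : ι, B s t = H s.1 t.1 := fun s t => rfl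
  have hBreal : ∀ s t : ι, star (B s t) = B s t := fun s t => hreal _ _
  have hBsymm : ∀ s t : ι, B s t = B t s := fun s t => hsymm _ _
  have hBoff : ∀ s t : ι, s ≠ t → (B s t).re ≤ 0 := fun s t hst =>
    hoff _ _ (fun h => hst (Subtype.ext h))
  -- connectivity inside the class
  have hconn : ∀ s t : ι, Relation.ReflTransGen (fun a b => B a b ≠ 0) s t := by
    have key : ∀ σ τ : TensorIndex Λ 2, Relation.ReflTransGen (DoubleFlipRel G) σ τ →
        ∀ hσ : (∑ z, (σ z : ℕ)) % 2 = r, ∃ hτ : (∑ z, (τ z : ℕ)) % 2 = r,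
          Relation.ReflTransGen (fun a b : ι => B a b ≠ 0) ⟨σ, hσ⟩ ⟨τ, hτ⟩ := by
      intro σ τ h
      induction h with
      | refl => exact fun hσ => ⟨hσ, Relation.ReflTransGen.refl⟩
      | @tail b c _ hbc ih =>
        intro hσ
        obtain ⟨hb, hpath⟩ := ih hσ
        obtain ⟨x, y, hxy, rfl⟩ := hbc
        have hc : (∑ z, (flipAt x (flipAt y b) z : ℕ)) % 2 = r := by rw [weight_flipAt_flipAt_mod_two]; exact hb
        exact ⟨hc, hpath.tail (by rw [hBapply]; exact hflip x y b hxy)⟩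
    intro s t
    obtain ⟨_, h⟩ := key s.1 t.1 (reflTransGen_doubleFlip_of_parity G hG s.1 t.1 (by rw [s.2, t.2])) s.2
    exact h
  -- extension by zero and restriction
  have hdot : ∀ (v : ι → ℂ) (w : TensorIndex Λ 2 → ℂ),
      star (fun σ => if h : (∑ z, (σ z : ℕ)) % 2 = r then v ⟨σ, h⟩ else 0) ⬝ᵥ w =
        star v ⬝ᵥ fun s => w s.1 := by
    intro v w
    rw [dotProduct, dotProduct, sum_eq_sum_subtype_of_support (fun σ => (∑ z, (σ z : ℕ)) % 2 = r)]
    · refine Finset.sum_congr rfl fun s _ => ?_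
      rw [Pi.star_apply, Pi.star_apply, dif_pos s.2]
    · intro σ hσ
      rw [Pi.star_apply, dif_neg hσ, star_zero, zero_mul]
  have hHext : ∀ (v : ι → ℂ) (s : ι),
      (H *ᵥ fun σ => if h : (∑ z, (σ z : ℕ)) % 2 = r then v ⟨σ, h⟩ else 0) s.1 = (B *ᵥ v) s := by
    intro v s
    rw [mulVec, dotProduct, mulVec, dotProduct,
      sum_eq_sum_subtype_of_support (fun σ => (∑ z, (σ z : ℕ)) % 2 = r)]
    · refine Finset.sum_congr rfl fun t _ => ?_
      rw [dif_pos t.2, hBapply, Subtype.coe_eta]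
    · intro τ hτ
      rw [dif_neg hτ, mul_zero]
  have hEB : ∀ v : ι → ℂ, E * (star v ⬝ᵥ v).re ≤ (star v ⬝ᵥ B *ᵥ v).re := by
    intro v
    set φ : TensorIndex Λ 2 → ℂ := fun σ => if h : (∑ z, (σ z : ℕ)) % 2 = r then v ⟨σ, h⟩ else 0 with hφdef
    have hφφ : star φ ⬝ᵥ φ = star v ⬝ᵥ v := by
      rw [hφdef, hdot]
      congr 1
      funext s
      rw [dif_pos s.2]
    have hφH : star φ ⬝ᵥ H *ᵥ φ = star v ⬝ᵥ B *ᵥ v := by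
      rw [hφdef, hdot]
      congr 1
      funext s
      rw [hHext]
    have := hE φ
    rw [hφφ, hφH] at this
    exact this
  have hres : ∀ φ : TensorIndex Λ 2 → ℂ, (∀ σ, (∑ z, (σ z : ℕ)) % 2 ≠ r → φ σ = 0) →
      H *ᵥ φ = (E : ℂ) • φ → B *ᵥ (fun s : ι => φ s.1) = (E : ℂ) • fun s : ι => φ s.1 := by
    intro φ hφ hHφ
    funext s
    rw [Pi.smul_apply, smul_eq_mul, mulVec, dotProduct]
    have h := congrFun hHφ s.1
    rw [Pi.smul_apply, smul_eq_mul, mulVec, dotProduct,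
      sum_eq_sum_subtype_of_support (fun σ => (∑ z, (σ z : ℕ)) % 2 = r)] at h
    · exact h
    · intro τ hτ
      rw [hφ τ hτ, mul_zero]
  have hres0 : ∀ φ : TensorIndex Λ 2 → ℂ, (∀ σ, (∑ z, (σ z : ℕ)) % 2 ≠ r → φ σ = 0) → φ ≠ 0 →
      (fun s : ι => φ s.1) ≠ 0 := by
    intro φ hφ hφ0 h
    apply hφ0
    funext σ
    by_cases hσ : (∑ z, (σ z : ℕ)) % 2 = r
    · exact congrFun h ⟨σ, hσ⟩
    · exact hφ σ hσ
  refine ⟨?_, ?_⟩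
  · intro w hw0 hw hHw
    obtain ⟨c, hc0, hcpos⟩ := perronFrobenius_groundState_smul_pos hBsymm hBreal hBoff hconn hEB
      (hres w hw hHw) (hres0 w hw hw0)
    exact ⟨c, hc0, fun σ hσ => hcpos ⟨σ, hσ⟩⟩
  · intro w w' hw hw' hHw hHw' hw0
    obtain ⟨c, hc⟩ := perronFrobenius_groundState_unique hBsymm hBreal hBoff hconn hEB
      (hres w hw hHw) (hres w' hw' hHw') (hres0 w hw hw0)
    refine ⟨c, funext fun σ => ?_⟩
    by_cases hσ : (∑ z, (σ z : ℕ)) % 2 = r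
    · have h := congrFun hc ⟨σ, hσ⟩
      simpa only [Pi.smul_apply, smul_eq_mul] using h
    · rw [Pi.smul_apply, smul_eq_mul, hw σ hσ, hw' σ hσ, mul_zero]

end Block

end Summit.HubbardSuperconductivity.HubbardSuperconductivity.Theorems.AnisotropyChord.Transfer
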